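import Literature.Probability.RandomPlanarGeometry.ObservableLimitPassage
import Literature.Probability.Process.StoppedValuePairing
import HarnessLib

/-!
# The martingale property passes to the scaling limit: discrete-martingale form

Topic `Literature/Probability/RandomPlanarGeometry` (family `crit-ising`); theorems only. Companion
of `ObservableLimitPassage.lean`, whose abstract passage theorem
`Loewner.integral_cylinder_eq_zero_of_tendstoInDistribution` derives CDHKS's cylinder identity
`E_μ[(N_t(W) - N_s(W)) ψ(W_S)] = 0` for the scaling limit `W` of driving processes `V^k → W`
(in distribution in `C([0, ∞), ℝ)`) from per-scale data `(A, B, bad)`: two random variables with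
the identity `E_k[(B - A) ψ(V^k_S)] = 0` approximating `N_u(V^k)` at times just after `s`, `t`.
Here that identity is discharged by Doob's optional sampling theorem, so that the per-scale
hypothesis takes exactly the shape delivered by the printed proofs (Duminil-Copin–Smirnov, Clay
Math. Proc. 15 (2012), Lemma 6.6 and proof of Prop. 6.7, p. 29; Chelkak–Duminil-Copin–Hongler–
Kemppainen–Smirnov, C. R. Math. 352 (2014), §3: "the value `F^δ_n(z^δ)` is a martingale with
respect to the filtration `(𝓕^δ_n)_{n ≥ 0}`, where `𝓕^δ_n` is generated by the first `n` steps of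
`γ^δ`" together with "`|F^δ_n(z) - M^δ_t(z)| → 0` as `δ → 0` uniformly over all possible domains
`Ω^δ_n` and all `z` in the bulk"):

* for every scale `k`, a discrete filtration `𝒢` on `(Ω' k, P k)` indexed by lattice steps
  `n ∈ ℕ`, a complex `𝒢`-martingale `F` (the normalised discrete observable of the slit domain
  after `n` steps; a Doob martingale by the domain Markov property, DCS Lemma 6.6), two
  `𝒢`-stopping times `σ ≤ τ ≤ M` (the first steps whose capacity exceeds `s`, resp. `t`, possibly
  cut off on leaving the bulk regime), such that the driving values `V^k_u`, `u ≤ s`, are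
  measurable for the stopped σ-algebra `𝒢_σ`, the stopped values `F_σ, F_τ` are a.e. bounded by
  `C'`, and, off an event `bad` of probability `≤ η_k`, `F_σ` and `F_τ` are within `ε_k` of
  `N_u(V^k)` at some times `u ∈ [s, s + Δ_k]`, resp. `[t, t + Δ_k]` (Smirnov's convergence theorem
  for the observable, and the capacity overshoot of one lattice step), with `ε_k, Δ_k, η_k → 0`.

Results (all PROVED):

* `Loewner.integral_cylinder_eq_zero_of_discreteMartingales` — the abstract passage in this form,
  for a bounded jointly continuous family of path functionals `N_u`;
* `Loewner.integral_observableProcess_cylinder_eq_zero_of_forall_lt` — for the time-limited FK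
  observable `N^y = Loewner.observableProcess W y` the cylinder identity for all `s ≤ t` follows
  from the cases `s < t < T(iy) = y²/9` (the observable is frozen after `T(iy)` and continuous in
  time; dominated convergence), extracted from the proof of
  `Loewner.integral_observableProcess_cylinder_eq_zero_of_tendstoInDistribution`;
* `Loewner.integral_observableProcess_cylinder_eq_zero_of_discreteMartingales` — **the analytic
  clause of (M5′)** (`Literature.Probability.LatticeModels.exists_cylinderObservableIdentity_fkInterface`,
  `LatticeModels/FKIsingNaturalMartingale.lean`) for a limit `(W, μ)` of driving processes, from
  discrete observable martingales at every scale: what remains of (M5′) after this file is (J) the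
  convergence in distribution of the capacity driving processes of the FK interfaces along the
  subsequence together with the regularity of the limit (Kemppainen–Smirnov 2017, Thm. 1.5 and
  Cor. 1.7, with CDHKS Thm. 4; CDHKS Thm. 3) and (D) the discrete observable martingale with
  Smirnov's convergence theorem in the slit domains (DCS Lemma 6.6, Thm. 3.15 = Smirnov 2010,
  Thm. 2.2), in the shape of the hypothesis `hD` below.

No definition and no named fact is introduced.

## References

* D. Chelkak, H. Duminil-Copin, C. Hongler, A. Kemppainen, S. Smirnov, *Convergence of Ising
  interfaces to Schramm's SLE curves*, C. R. Math. Acad. Sci. Paris 352 (2014) 157–161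
  (arXiv:1312.0533), Thm. 3 and §3 (pp. 7–8 of the arXiv version).
* H. Duminil-Copin, S. Smirnov, *Conformal invariance of lattice models*, Clay Math. Proc. 15
  (2012) 213–276 (arXiv:1109.1549): Lemma 6.6, Thm. 3.15, proof of Prop. 6.7 (p. 29).
* O. Kallenberg, *Foundations of Modern Probability*, 3rd ed. (2021), Thm. 7.12 (optional
  sampling).
-/

noncomputable section

open MeasureTheory Filter Topology Set Complex
open scoped NNReal ENNReal
open Literature.Probability.Process

namespace Literature.Probability.RandomPlanarGeometry

namespace Loewner

section DiscretePassage

variable {Ω : Type*} {mΩ : MeasurableSpace Ω} {μ : Measure Ω} [IsProbabilityMeasure μ]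
  {Ω' : ℕ → Type*} {mΩ' : ∀ k, MeasurableSpace (Ω' k)} {P : ∀ k, Measure (Ω' k)}
  [∀ k, IsProbabilityMeasure (P k)]
  [MeasurableSpace C(ℝ≥0, ℝ)] [OpensMeasurableSpace C(ℝ≥0, ℝ)]

/-- **The martingale property passes to the scaling limit, discrete-martingale form.** Setting
as in `integral_cylinder_eq_zero_of_tendstoInDistribution`: continuous-path real processes `V k`
on probability spaces `(Ω' k, P k)` converging in distribution in `C([0, ∞), ℝ)` to the
continuous-path process `W` on `(Ω, μ)`; a bounded family of path functionals `N_u(w)`, jointly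
continuous in `(u, w)`; a bounded continuous cylinder test function `ψ` at times `S ≤ s`.
Hypothesis, for every scale `k`: a filtration `𝒢` on `ℕ`, a complex `𝒢`-martingale `F`,
stopping times `σ ≤ τ ≤ M` such that every `V^k_u`, `u ≤ s`, is `𝒢_σ`-measurable, the stopped
values `F_σ`, `F_τ` are a.e. bounded by `C'`, and off an event `bad` with `P_k(bad) ≤ η_k` they
approximate `N_u(V^k)` within `ε_k` at some `u ∈ [s, s + Δ_k]`, resp. `[t, t + Δ_k]`, where
`ε_k, Δ_k, η_k → 0`. Conclusion: `E_μ[(N_t(W) - N_s(W)) ψ(W_S)] = 0`. PROVED: the per-scale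
identity `E_k[(F_τ - F_σ) ψ(V^k_S)] = 0` is Doob's optional sampling theorem in pairing form
(`Process.integral_stoppedValue_sub_mul_cylinder_eq_zero`), and the rest is
`integral_cylinder_eq_zero_of_tendstoInDistribution` with `A = F_σ`, `B = F_τ`. This is the step
"Recall that … `F^δ_n(z^δ)` is a martingale with respect to the filtration `(𝓕^δ_n)` … we conclude
that … `M_t(z)` … is a martingale" of CDHKS (2014), §3, given its inputs.
[cite: CDHKSCRAS2014, §3] [cite: DuminilCopinSmirnov2012Clay, Lemma 6.6 and proof of Prop. 6.7 (p. 29)] -/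
theorem integral_cylinder_eq_zero_of_discreteMartingales
    {W : ℝ≥0 → Ω → ℝ} (hWc : ∀ ω, Continuous (W · ω))
    {V : ∀ k, ℝ≥0 → Ω' k → ℝ} (hVc : ∀ k ω, Continuous (V k · ω))
    (hlaw : TendstoInDistribution (fun k ω ↦ (⟨fun u ↦ V k u ω, hVc k ω⟩ : C(ℝ≥0, ℝ))) atTop
      (fun ω ↦ (⟨fun u ↦ W u ω, hWc ω⟩ : C(ℝ≥0, ℝ))) P μ)
    {N : ℝ≥0 → C(ℝ≥0, ℝ) → ℂ} (hN : Continuous (Function.uncurry N)) {C : ℝ}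
    (hNC : ∀ u w, ‖N u w‖ ≤ C) (s t : ℝ≥0) {n : ℕ} {S : Fin n → ℝ≥0} (hS : ∀ i, S i ≤ s)
    {ψ : (Fin n → ℝ) → ℝ} (hψc : Continuous ψ) (hψ1 : ∀ v, |ψ v| ≤ 1) {C' : ℝ} {ε Δ η : ℕ → ℝ≥0}
    (hε : Tendsto ε atTop (𝓝 0)) (hΔ : Tendsto Δ atTop (𝓝 0)) (hη : Tendsto η atTop (𝓝 0))
    (hD : ∀ k, ∃ (𝒢 : Filtration ℕ (mΩ' k)) (F : ℕ → Ω' k → ℂ) (σ τ : Ω' k → WithTop ℕ)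
      (hσ : IsStoppingTime 𝒢 σ) (M : ℕ) (bad : Set (Ω' k)),
      IsStoppingTime 𝒢 τ ∧ Martingale F 𝒢 (P k) ∧ σ ≤ τ ∧ (∀ ω, τ ω ≤ M) ∧
      (∀ u, u ≤ s → Measurable[hσ.measurableSpace] (V k u)) ∧
      (∀ᵐ ω ∂P k, ‖stoppedValue F σ ω‖ ≤ C') ∧ (∀ᵐ ω ∂P k, ‖stoppedValue F τ ω‖ ≤ C') ∧
      MeasurableSet bad ∧ P k bad ≤ η k ∧
      ∀ᵐ ω ∂P k, ω ∉ bad →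
        (∃ u ∈ Icc s (s + Δ k), ‖stoppedValue F σ ω - N u ⟨fun r ↦ V k r ω, hVc k ω⟩‖ ≤ ε k) ∧
        (∃ u ∈ Icc t (t + Δ k), ‖stoppedValue F τ ω - N u ⟨fun r ↦ V k r ω, hVc k ω⟩‖ ≤ ε k)) :
    ∫ ω, (N t ⟨fun u ↦ W u ω, hWc ω⟩ - N s ⟨fun u ↦ W u ω, hWc ω⟩) *
      (ψ (fun i ↦ W (S i) ω) : ℂ) ∂μ = 0 := by
  refine integral_cylinder_eq_zero_of_tendstoInDistribution hWc hVc hlaw hN hNC s t S hψc hψ1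
    (C' := C') hε hΔ hη fun k ↦ ?_
  obtain ⟨𝒢, F, σ, τ, hσ, M, bad, hτ, hF, hστ, hτM, hVm, hbσ, hbτ, hbad, hPbad, happ⟩ := hD k
  have hσM : ∀ ω, σ ω ≤ M := fun ω ↦ (hστ ω).trans (hτM ω)
  refine ⟨stoppedValue F σ, stoppedValue F τ, bad, hbad, hPbad,
    (integrable_stoppedValue ℕ hσ hF.integrable hσM).aestronglyMeasurable,
    (integrable_stoppedValue ℕ hτ hF.integrable hτM).aestronglyMeasurable, hbσ, hbτ, ?_, happ⟩
  exact integral_stoppedValue_sub_mul_cylinder_eq_zero hF hσ hτ hστ hτM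
    (fun i ↦ hVm (S i) (hS i)) hψc.measurable hψ1

/-- **Extension of the cylinder identity past the time horizon.** For a continuous-path process
`W` on `(Ω, μ)` whose path map is a.e. measurable, `y > 0`, a time `s` and a bounded continuous
cylinder test function `ψ(W_S)`: if `E_μ[(N^y_t(W) - N^y_s(W)) ψ(W_S)] = 0` for all `t` with
`s < t < T(iy) = y²/9`, then the identity holds for every `t ≥ s` — the time-limited observable
`N^y_u = O_{u ∧ T(iy)}(iy)` (`observableProcess`) is constant in `u ≥ T(iy)` and continuous in `u`
(`continuous_fkObservable_min_cdhksTime`), bounded by `2` (`norm_fkObservable_min_le`), so the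
case `t ≥ T(iy) > s` follows by letting `t ↑ T(iy)` under the integral (dominated convergence),
and the case `s ≥ T(iy)` is trivial. Extracted from the proof of
`integral_observableProcess_cylinder_eq_zero_of_tendstoInDistribution`. [cite: CDHKSCRAS2014, §3] -/
theorem integral_observableProcess_cylinder_eq_zero_of_forall_lt
    {W : ℝ≥0 → Ω → ℝ} (hWc : ∀ ω, Continuous (W · ω))
    (hWm : AEMeasurable (fun ω ↦ (⟨fun r ↦ W r ω, hWc ω⟩ : C(ℝ≥0, ℝ))) μ)
    {y : ℝ} (hy : 0 < y) {s : ℝ≥0} {n : ℕ} (S : Fin n → ℝ≥0) {ψ : (Fin n → ℝ) → ℝ}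
    (hψc : Continuous ψ) (hψ1 : ∀ v, |ψ v| ≤ 1)
    (h : ∀ t : ℝ≥0, s < t → t < cdhksTime y →
      ∫ ω, (observableProcess W y t ω - observableProcess W y s ω) *
        (ψ (fun i ↦ W (S i) ω) : ℂ) ∂μ = 0)
    {t : ℝ≥0} (hst : s ≤ t) :
    ∫ ω, (observableProcess W y t ω - observableProcess W y s ω) *
      (ψ (fun i ↦ W (S i) ω) : ℂ) ∂μ = 0 := by
  -- the functional `N^y_u(w) = O_{u ∧ T(iy)}^w(iy)` on path space, made opaque
  obtain ⟨N, hN⟩ : ∃ N : ℝ≥0 → C(ℝ≥0, ℝ) → ℂ,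
      N = fun u (w : C(ℝ≥0, ℝ)) ↦ fkObservable w (min u (cdhksTime y)) (I * y) := ⟨_, rfl⟩
  have hNc : Continuous (Function.uncurry N) := by
    rw [hN]; exact continuous_fkObservable_min_cdhksTime hy
  have hNC : ∀ u w, ‖N u w‖ ≤ 2 := fun u w ↦ by
    rw [hN]; exact norm_fkObservable_min_le w.continuous hy u
  have hfreeze : ∀ u : ℝ≥0, cdhksTime y ≤ u → ∀ w, N u w = N (cdhksTime y) w := by
    intro u hu w
    rw [hN]
    simp only [min_eq_right hu, min_self]
  have hobs : ∀ u ω, observableProcess W y u ω = N u ⟨fun r ↦ W r ω, hWc ω⟩ := by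
    intro u ω; rw [hN]; rfl
  simp only [hobs] at h ⊢
  clear hobs
  have hevalc : Continuous fun w : C(ℝ≥0, ℝ) ↦ (fun i ↦ w (S i) : Fin n → ℝ) :=
    continuous_pi fun i ↦ continuous_eval_const (S i)
  have hNt : ∀ u, Continuous fun w : C(ℝ≥0, ℝ) ↦ N u w := fun u ↦
    hNc.comp (continuous_const.prodMk continuous_id)
  have hNu : ∀ w, Continuous fun u : ℝ≥0 ↦ N u w := fun w ↦
    hNc.comp (continuous_id.prodMk continuous_const)
  rcases hst.eq_or_lt with rfl | hst'
  · simp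
  rcases lt_or_ge t (cdhksTime y) with htT | htT
  · exact h t hst' htT
  rcases le_or_gt (cdhksTime y) s with hsT | hsT
  · have h0 : ∀ ω, N t ⟨fun r ↦ W r ω, hWc ω⟩ - N s ⟨fun r ↦ W r ω, hWc ω⟩ = 0 := fun ω ↦ by
      rw [hfreeze t htT, hfreeze s hsT, sub_self]
    simp [h0]
  simp_rw [hfreeze t htT]
  -- approximate `T(iy)` from below by times `tm m ∈ (s, T(iy))`
  obtain ⟨tm, -, htm_mem, htm_lim⟩ := exists_seq_strictMono_tendsto' hsT
  have hm : ∀ m, ∫ ω, (N (tm m) ⟨fun r ↦ W r ω, hWc ω⟩ - N s ⟨fun r ↦ W r ω, hWc ω⟩) *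
      (ψ (fun i ↦ W (S i) ω) : ℂ) ∂μ = 0 :=
    fun m ↦ h (tm m) (htm_mem m).1 (htm_mem m).2
  have hψC : Continuous fun w : C(ℝ≥0, ℝ) ↦ (ψ (fun i ↦ w (S i)) : ℂ) :=
    continuous_ofReal.comp (hψc.comp hevalc)
  have hmeas : ∀ u : ℝ≥0, AEStronglyMeasurable (fun ω ↦ (N u ⟨fun r ↦ W r ω, hWc ω⟩ -
      N s ⟨fun r ↦ W r ω, hWc ω⟩) * (ψ (fun i ↦ W (S i) ω) : ℂ)) μ := fun u ↦ by
    have hc : Continuous fun w : C(ℝ≥0, ℝ) ↦ (N u w - N s w) * (ψ (fun i ↦ w (S i)) : ℂ) :=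
      ((hNt u).sub (hNt s)).mul hψC
    exact (hc.measurable.comp_aemeasurable hWm).aestronglyMeasurable
  have hbd : ∀ (u : ℝ≥0) ω, ‖(N u ⟨fun r ↦ W r ω, hWc ω⟩ - N s ⟨fun r ↦ W r ω, hWc ω⟩) *
      (ψ (fun i ↦ W (S i) ω) : ℂ)‖ ≤ 4 := fun u ω ↦ by
    rw [norm_mul, Complex.norm_real, Real.norm_eq_abs]
    have hu4 := hNC u ⟨fun r ↦ W r ω, hWc ω⟩
    have hs4 := hNC s ⟨fun r ↦ W r ω, hWc ω⟩
    have h1 : ‖N u ⟨fun r ↦ W r ω, hWc ω⟩ - N s ⟨fun r ↦ W r ω, hWc ω⟩‖ ≤ 4 :=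
      (norm_sub_le _ _).trans (by linarith)
    calc ‖N u ⟨fun r ↦ W r ω, hWc ω⟩ - N s ⟨fun r ↦ W r ω, hWc ω⟩‖ * |ψ fun i ↦ W (S i) ω|
        ≤ 4 * 1 := mul_le_mul h1 (hψ1 _) (abs_nonneg _) (by norm_num)
      _ = 4 := by norm_num
  have hlim : Tendsto (fun m ↦ ∫ ω, (N (tm m) ⟨fun r ↦ W r ω, hWc ω⟩ -
      N s ⟨fun r ↦ W r ω, hWc ω⟩) * (ψ (fun i ↦ W (S i) ω) : ℂ) ∂μ) atTop
      (𝓝 (∫ ω, (N (cdhksTime y) ⟨fun r ↦ W r ω, hWc ω⟩ - N s ⟨fun r ↦ W r ω, hWc ω⟩) *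
        (ψ (fun i ↦ W (S i) ω) : ℂ) ∂μ)) := by
    refine tendsto_integral_of_dominated_convergence (fun _ ↦ 4) (fun m ↦ hmeas _)
      (integrable_const _) (fun m ↦ ae_of_all _ fun ω ↦ hbd _ ω) (ae_of_all _ fun ω ↦ ?_)
    exact ((((hNu _).tendsto _).comp htm_lim).sub tendsto_const_nhds).mul tendsto_const_nhds
  have h0 : Tendsto (fun m ↦ ∫ ω, (N (tm m) ⟨fun r ↦ W r ω, hWc ω⟩ -
      N s ⟨fun r ↦ W r ω, hWc ω⟩) * (ψ (fun i ↦ W (S i) ω) : ℂ) ∂μ) atTop (𝓝 0) := by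
    simp_rw [hm]
    exact tendsto_const_nhds
  exact tendsto_nhds_unique hlim h0

/-- **The analytic clause of (M5′) from discrete observable martingales.** Let the continuous-path
driving processes `V k` on `(Ω' k, P k)` converge in distribution in `C([0, ∞), ℝ)` to the
continuous-path process `W` on `(Ω, μ)` (for the FK-Ising interfaces along a subsequence:
Kemppainen–Smirnov's Cor. 1.7 with CDHKS Thm. 4, i.e. CDHKS Thm. 3), and let `y > 0`. Suppose
that for all `s < t < T(iy) = y²/9` there are constants `C'` and null sequences `ε, Δ, η` such
that every scale `k` carries a discrete filtration `𝒢` (the lattice steps of the exploration), a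
complex `𝒢`-martingale `F` (the normalised fermionic observable of the slit domain at a lattice
point near `φ_k⁻¹(iy)`, a martingale by the domain Markov property: Duminil-Copin–Smirnov 2012,
Lemma 6.6) and `𝒢`-stopping times `σ ≤ τ ≤ M` (the first lattice steps of capacity `≥ s`, `≥ t`)
such that the driving values `V^k_u`, `u ≤ s`, are `𝒢_σ`-measurable, `‖F_σ‖, ‖F_τ‖ ≤ C'` a.e.,
and off an event of probability `≤ η_k` the stopped values are within `ε_k` of the time-limited
observable `N^y_u(V^k) = observableProcess (V k) y u` at some `u ∈ [s, s + Δ_k]`, resp.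
`[t, t + Δ_k]` (Smirnov's convergence theorem uniformly over the slit domains, DCS Thm. 3.15 =
Smirnov 2010, Thm. 2.2, in CDHKS's form "`|F^δ_n(z) - M^δ_t(z)| → 0` uniformly over all possible
domains", plus the capacity overshoot of one lattice step). Then for ALL `s ≤ t`, all finite
families of times `S ≤ s` and all continuous `ψ` with `|ψ| ≤ 1`,
`E_μ[(N^y_t(W) - N^y_s(W)) ψ(W_S)] = 0` — literally the last clause of
`LatticeModels.exists_cylinderObservableIdentity_fkInterface` for `(W, μ)`. PROVED
(`integral_cylinder_eq_zero_of_discreteMartingales` for `s < t < T(iy)`, then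
`integral_observableProcess_cylinder_eq_zero_of_forall_lt`).
[cite: CDHKSCRAS2014, Thm. 3 and §3] [cite: DuminilCopinSmirnov2012Clay, Lemma 6.6, Thm. 3.15 and proof of Prop. 6.7 (p. 29)] -/
theorem integral_observableProcess_cylinder_eq_zero_of_discreteMartingales
    {W : ℝ≥0 → Ω → ℝ} (hWc : ∀ ω, Continuous (W · ω))
    {V : ∀ k, ℝ≥0 → Ω' k → ℝ} (hVc : ∀ k ω, Continuous (V k · ω))
    (hlaw : TendstoInDistribution (fun k ω ↦ (⟨fun u ↦ V k u ω, hVc k ω⟩ : C(ℝ≥0, ℝ))) atTop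
      (fun ω ↦ (⟨fun u ↦ W u ω, hWc ω⟩ : C(ℝ≥0, ℝ))) P μ)
    {y : ℝ} (hy : 0 < y)
    (hD : ∀ s t : ℝ≥0, s < t → t < cdhksTime y →
      ∃ (C' : ℝ) (ε Δ η : ℕ → ℝ≥0), Tendsto ε atTop (𝓝 0) ∧ Tendsto Δ atTop (𝓝 0) ∧
        Tendsto η atTop (𝓝 0) ∧
        ∀ k, ∃ (𝒢 : Filtration ℕ (mΩ' k)) (F : ℕ → Ω' k → ℂ) (σ τ : Ω' k → WithTop ℕ)
          (hσ : IsStoppingTime 𝒢 σ) (M : ℕ) (bad : Set (Ω' k)),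
          IsStoppingTime 𝒢 τ ∧ Martingale F 𝒢 (P k) ∧ σ ≤ τ ∧ (∀ ω, τ ω ≤ M) ∧
          (∀ u, u ≤ s → Measurable[hσ.measurableSpace] (V k u)) ∧
          (∀ᵐ ω ∂P k, ‖stoppedValue F σ ω‖ ≤ C') ∧ (∀ᵐ ω ∂P k, ‖stoppedValue F τ ω‖ ≤ C') ∧
          MeasurableSet bad ∧ P k bad ≤ η k ∧
          ∀ᵐ ω ∂P k, ω ∉ bad →
            (∃ u ∈ Icc s (s + Δ k), ‖stoppedValue F σ ω - observableProcess (V k) y u ω‖ ≤ ε k) ∧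
            (∃ u ∈ Icc t (t + Δ k), ‖stoppedValue F τ ω - observableProcess (V k) y u ω‖ ≤ ε k)) :
    ∀ s t : ℝ≥0, s ≤ t → ∀ (n : ℕ) (S : Fin n → ℝ≥0), (∀ i, S i ≤ s) →
      ∀ ψ : (Fin n → ℝ) → ℝ, Continuous ψ → (∀ v, |ψ v| ≤ 1) →
        ∫ ω, (observableProcess W y t ω - observableProcess W y s ω) *
          (ψ (fun i ↦ W (S i) ω) : ℂ) ∂μ = 0 := by
  intro s t hst n S hS ψ hψc hψ1
  refine integral_observableProcess_cylinder_eq_zero_of_forall_lt hWc hlaw.aemeasurable_limit hy S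
    hψc hψ1 (fun t' hst' ht'T ↦ ?_) hst
  obtain ⟨C', ε, Δ, η, hε, hΔ, hη, hDk⟩ := hD s t' hst' ht'T
  -- the functional `N^y` on path space
  obtain ⟨N, hN⟩ : ∃ N : ℝ≥0 → C(ℝ≥0, ℝ) → ℂ,
      N = fun u (w : C(ℝ≥0, ℝ)) ↦ fkObservable w (min u (cdhksTime y)) (I * y) := ⟨_, rfl⟩
  have hNc : Continuous (Function.uncurry N) := by
    rw [hN]; exact continuous_fkObservable_min_cdhksTime hy
  have hNC : ∀ u w, ‖N u w‖ ≤ 2 := fun u w ↦ by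
    rw [hN]; exact norm_fkObservable_min_le w.continuous hy u
  have hobs : ∀ u ω, observableProcess W y u ω = N u ⟨fun r ↦ W r ω, hWc ω⟩ := by
    intro u ω; rw [hN]; rfl
  have hobsV : ∀ k u ω, observableProcess (V k) y u ω = N u ⟨fun r ↦ V k r ω, hVc k ω⟩ := by
    intro k u ω; rw [hN]; rfl
  simp only [hobsV] at hDk
  simp only [hobs]
  exact integral_cylinder_eq_zero_of_discreteMartingales hWc hVc hlaw hNc hNC s t' hS hψc hψ1
    hε hΔ hη hDk

end DiscretePassage

end Loewner

end Literature.Probability.RandomPlanarGeometry
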